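import Literature.AlgebraicGeometry.Motives.GrassmannianSectionsAffine
import HarnessLib

/-!
# Functoriality of the Grassmannian sheaf and scheme in natural transformations of the affine functor

Topic `AlgebraicGeometry/Motives`; namespace `Literature.AlgebraicGeometry.Motives.Grassmannian`.  DEFINITIONS with bodies
(`affineSheafHomOfNatTrans`, `sheafHomOfNatTrans`, `schemeHomOfNatTrans`) and theorems; no instance, no notation, no named fact,
no `sorry`.  BYTES: B-p21 (g16) (author; draft parked 2026-08-30T05:42:32Z as
`B-provers/B-p21/g16/GrassmannianSheafFunctoriality.draft-NOT-FILED.B-p21g16.lean`), filed unchanged below this docstring by the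
first consumer B-p12 (g15) (`Motives/GrassmannianFunctoriality`, functoriality of `Gr(k, M)` in `M`; announced on the cell bus
06:04:32Z, no objection).

[GortzWedhorn2020, Ch. 8 Exercise 8.1] (a Zariski sheaf on affine schemes extends uniquely to all schemes; morphisms likewise) and
[GortzWedhorn2020, (8.4) (pp. 213–215)] (the Grassmannian functor and its representing scheme).  For a natural transformation
`η : grassmannianFunctor M k ⟶ grassmannianFunctor M′ k′` of the AFFINE functors `A ↦ G(k, A ⊗ M; A)`:

* §1 `sheafHomOfNatTrans η : grassmannianSheaf M k ⟶ grassmannianSheaf M′ k′` (through the comparison equivalence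
  ★ `isEquivalence_sheafPushforwardContinuous_Spec`), functorial (`_id`, `_comp`), computed on affines / affine opens
  (`specEquiv_sheafHomOfNatTrans_app`, `evalAffine_sheafHomOfNatTrans_app`) and UNIQUE with that property (`eq_sheafHomOfNatTrans`,
  ★ `hom_ext_of_app_Spec`);
* §2 under representability: `schemeHomOfNatTrans η : grassmannianScheme M k ⟶ grassmannianScheme M′ k′` (Yoneda), its functor of
  points (`pointsEquiv_comp_…`, `specPointsEquiv_comp_…`, `evalAffine_pointsEquiv_comp_…`) and `mono_schemeHomOfNatTrans` (injective
  on every ring ⇒ monomorphism, ★ `hom_ext_of_evalAffine`).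

Instances: the Plücker embedding (★ `Motives/GrassmannianPlucker`, `pluckerSheafHom = sheafHomOfNatTrans (pluckerNatTrans M k)`),
functoriality in `M` (`Motives/GrassmannianFunctoriality`).  Cell `hodgecm-mathlib` (D-0151), (h4) capital; nothing here is about HC
— HC_CM is proved only modulo the 7 printed citations until rung 0 closes.

## References
* [GortzWedhorn2020] U. Görtz, T. Wedhorn, *Algebraic Geometry I*, 2nd ed. (2020), (8.4) (pp. 213–215); Ch. 8 Exercise 8.1.
* [StacksProject] The Stacks project, Tag 020W (Zariski sheaves and affine schemes), Tag 089R.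
-/

noncomputable section

namespace Literature.AlgebraicGeometry.Motives.Grassmannian

open CategoryTheory Opposite TensorProduct _root_.AlgebraicGeometry

universe u

variable {M : Type u} [AddCommGroup M] {k : ℕ} {M' : Type u} [AddCommGroup M'] {k' : ℕ}
  {M'' : Type u} [AddCommGroup M''] {k'' : ℕ}

/-! ## §1 Sheaf level -/

/-- The morphism of Zariski sheaves on AFFINE schemes induced by a natural transformation of the Grassmannian functors
(whiskering along `unopUnop`). [cite: GortzWedhorn2020, Ch. 8 Exercise 8.1] -/
def affineSheafHomOfNatTrans (η : grassmannianFunctor.{u, u} M k ⟶ grassmannianFunctor.{u, u} M' k') :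
    grassmannianAffineSheaf M k ⟶ grassmannianAffineSheaf M' k' :=
  ⟨Functor.whiskerLeft (unopUnop CommRingCat.{u}) η⟩

/-- **The morphism of Grassmannian sheaves `grassmannianSheaf M k ⟶ grassmannianSheaf M' k'` induced by a natural
transformation `η` of the affine functors `A ↦ G(k, A ⊗ M; A)`** — the comparison-equivalence inverse («extend to all
schemes», ★ `isEquivalence_sheafPushforwardContinuous_Spec`) applied to `η`. [cite: GortzWedhorn2020, Ch. 8 Exercise 8.1] -/
def sheafHomOfNatTrans (η : grassmannianFunctor.{u, u} M k ⟶ grassmannianFunctor.{u, u} M' k') :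
    grassmannianSheaf M k ⟶ grassmannianSheaf M' k' :=
  haveI := isEquivalence_sheafPushforwardContinuous_Spec.{u}
  (Scheme.Spec.sheafPushforwardContinuous (Type u) (Scheme.Spec.inducedTopology Scheme.zariskiTopology.{u})
    Scheme.zariskiTopology.{u}).inv.map (affineSheafHomOfNatTrans η)

/-- `sheafHomOfNatTrans` preserves identities. [cite: GortzWedhorn2020, Ch. 8 Exercise 8.1] -/
@[simp]
theorem sheafHomOfNatTrans_id : sheafHomOfNatTrans (𝟙 (grassmannianFunctor.{u, u} M k)) = 𝟙 _ :=
  haveI := isEquivalence_sheafPushforwardContinuous_Spec.{u}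
  CategoryTheory.Functor.map_id
    (Scheme.Spec.sheafPushforwardContinuous (Type u) (Scheme.Spec.inducedTopology Scheme.zariskiTopology.{u})
      Scheme.zariskiTopology.{u}).inv (grassmannianAffineSheaf M k)

/-- `sheafHomOfNatTrans` preserves composition. [cite: GortzWedhorn2020, Ch. 8 Exercise 8.1] -/
theorem sheafHomOfNatTrans_comp (η : grassmannianFunctor.{u, u} M k ⟶ grassmannianFunctor.{u, u} M' k')
    (η' : grassmannianFunctor.{u, u} M' k' ⟶ grassmannianFunctor.{u, u} M'' k'') :
    sheafHomOfNatTrans (η ≫ η') = sheafHomOfNatTrans η ≫ sheafHomOfNatTrans η' :=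
  haveI := isEquivalence_sheafPushforwardContinuous_Spec.{u}
  CategoryTheory.Functor.map_comp
    (Scheme.Spec.sheafPushforwardContinuous (Type u) (Scheme.Spec.inducedTopology Scheme.zariskiTopology.{u})
      Scheme.zariskiTopology.{u}).inv (affineSheafHomOfNatTrans η) (affineSheafHomOfNatTrans η')

/-- **On affine schemes the induced morphism IS `η`**: `specEquiv (sheafHomOfNatTrans η x) = η_A (specEquiv x)` for
`x ∈ Gr(Spec A)` (naturality of the counit of the comparison equivalence). [cite: GortzWedhorn2020, Ch. 8 Exercise 8.1] -/
theorem specEquiv_sheafHomOfNatTrans_app (η : grassmannianFunctor.{u, u} M k ⟶ grassmannianFunctor.{u, u} M' k')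
    (A : CommRingCat.{u}) (x : (grassmannianSheaf M k).obj.obj (op (Spec A))) :
    specEquiv M' k' A ((sheafHomOfNatTrans η).hom.app (op (Spec A)) x) = η.app A (specEquiv M k A x) := by
  haveI := isEquivalence_sheafPushforwardContinuous_Spec.{u}
  have h := (Scheme.Spec.sheafPushforwardContinuous (Type u) (Scheme.Spec.inducedTopology Scheme.zariskiTopology.{u})
    Scheme.zariskiTopology.{u}).asEquivalence.counitIso.hom.naturality (affineSheafHomOfNatTrans η)
  have h' := congrArg (fun φ => φ.hom.app (op (op A)) x) h
  exact h'

/-- **On affine opens the induced morphism acts by `η`**: `evalAffine U (sheafHomOfNatTrans η x) = η_{Γ(T,U)} (evalAffine U x)`.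
[cite: GortzWedhorn2020, Ch. 8 Exercise 8.1] -/
theorem evalAffine_sheafHomOfNatTrans_app (η : grassmannianFunctor.{u, u} M k ⟶ grassmannianFunctor.{u, u} M' k')
    {T : Scheme.{u}} {U : T.Opens} (hU : IsAffineOpen U) (x : (grassmannianSheaf M k).obj.obj (op T)) :
    evalAffine hU ((sheafHomOfNatTrans η).hom.app (op T) x) = η.app Γ(T, U) (evalAffine hU x) := by
  rw [evalAffine_def, evalAffine_def, ← specEquiv_sheafHomOfNatTrans_app, NatTrans.naturality_apply]

/-- **Uniqueness**: a morphism of Grassmannian sheaves acting by `η` on affine schemes is `sheafHomOfNatTrans η`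
(★ `hom_ext_of_app_Spec`). [cite: GortzWedhorn2020, Ch. 8 Exercise 8.1] -/
theorem eq_sheafHomOfNatTrans (η : grassmannianFunctor.{u, u} M k ⟶ grassmannianFunctor.{u, u} M' k')
    (φ : grassmannianSheaf M k ⟶ grassmannianSheaf M' k')
    (hφ : ∀ (A : CommRingCat.{u}) (x : (grassmannianSheaf M k).obj.obj (op (Spec A))),
      specEquiv M' k' A (φ.hom.app (op (Spec A)) x) = η.app A (specEquiv M k A x)) :
    φ = sheafHomOfNatTrans η := by
  refine hom_ext_of_app_Spec φ _ fun A => ?_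
  ext x
  apply (specEquiv M' k' A).injective
  exact (hφ A x).trans (specEquiv_sheafHomOfNatTrans_app η A x).symm

/-! ## §2 Scheme level -/

section Scheme

variable [(grassmannianSheaf M k).obj.IsRepresentable] [(grassmannianSheaf M' k').obj.IsRepresentable]

/-- **The morphism of Grassmannian schemes induced by `η`**: the morphism classified by the image under
`sheafHomOfNatTrans η` of the universal section `pointsEquiv (𝟙 Gr)` (Yoneda). [cite: GortzWedhorn2020, (8.4) (pp. 213–215)] -/
def schemeHomOfNatTrans (η : grassmannianFunctor.{u, u} M k ⟶ grassmannianFunctor.{u, u} M' k') :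
    grassmannianScheme M k ⟶ grassmannianScheme M' k' :=
  (pointsEquiv M' k' _).symm
    ((sheafHomOfNatTrans η).hom.app (op (grassmannianScheme M k)) (pointsEquiv M k _ (𝟙 _)))

/-- **Functor of points of the induced morphism**: `pointsEquiv (f ≫ schemeHomOfNatTrans η) = sheafHomOfNatTrans η (pointsEquiv f)`.
[cite: GortzWedhorn2020, (8.4) (pp. 213–215)] -/
theorem pointsEquiv_comp_schemeHomOfNatTrans (η : grassmannianFunctor.{u, u} M k ⟶ grassmannianFunctor.{u, u} M' k')
    {T : Scheme.{u}} (f : T ⟶ grassmannianScheme M k) :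
    pointsEquiv M' k' T (f ≫ schemeHomOfNatTrans η) =
      (sheafHomOfNatTrans η).hom.app (op T) (pointsEquiv M k T f) := by
  rw [pointsEquiv_comp, schemeHomOfNatTrans, Equiv.apply_symm_apply, ← NatTrans.naturality_apply,
    ← pointsEquiv_comp, Category.comp_id]

/-- **On `A`-valued points the induced morphism is `η_A`**:
`specPointsEquiv (g ≫ schemeHomOfNatTrans η) = η_A (specPointsEquiv g)`. [cite: GortzWedhorn2020, (8.4) (pp. 213–215)] -/
theorem specPointsEquiv_comp_schemeHomOfNatTrans (η : grassmannianFunctor.{u, u} M k ⟶ grassmannianFunctor.{u, u} M' k')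
    {A : CommRingCat.{u}} (g : Spec A ⟶ grassmannianScheme M k) :
    specPointsEquiv M' k' A (g ≫ schemeHomOfNatTrans η) = η.app A (specPointsEquiv M k A g) := by
  simp only [specPointsEquiv, Equiv.trans_apply, pointsEquiv_comp_schemeHomOfNatTrans, specEquiv_sheafHomOfNatTrans_app]

/-- **On affine opens of a `T`-point the induced morphism acts by `η`**. [cite: GortzWedhorn2020, (8.4) (pp. 213–215)] -/
theorem evalAffine_pointsEquiv_comp_schemeHomOfNatTrans
    (η : grassmannianFunctor.{u, u} M k ⟶ grassmannianFunctor.{u, u} M' k') {T : Scheme.{u}} {U : T.Opens}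
    (hU : IsAffineOpen U) (f : T ⟶ grassmannianScheme M k) :
    evalAffine hU (pointsEquiv M' k' T (f ≫ schemeHomOfNatTrans η)) = η.app Γ(T, U) (evalAffine hU (pointsEquiv M k T f)) := by
  rw [pointsEquiv_comp_schemeHomOfNatTrans, evalAffine_sheafHomOfNatTrans_app]

/-- **A natural transformation injective on every ring induces a monomorphism of Grassmannian schemes** (two
`T`-points with the same image have the same quotients on every affine open, ★ `hom_ext_of_evalAffine`).
[cite: GortzWedhorn2020, (8.4) (pp. 213–215)] -/
theorem mono_schemeHomOfNatTrans (η : grassmannianFunctor.{u, u} M k ⟶ grassmannianFunctor.{u, u} M' k')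
    (hη : ∀ A : CommRingCat.{u}, Function.Injective (η.app A)) : Mono (schemeHomOfNatTrans η) := by
  refine ⟨fun f₁ f₂ h => ?_⟩
  refine hom_ext_of_evalAffine M k fun V hV => hη Γ(_, V) ?_
  rw [← evalAffine_pointsEquiv_comp_schemeHomOfNatTrans, ← evalAffine_pointsEquiv_comp_schemeHomOfNatTrans, h]

end Scheme

end Literature.AlgebraicGeometry.Motives.Grassmannian

end
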